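import Summits.AtomisticToContinuum.BoseEinsteinCondensation.Theses.BECHardSphereReduction
import Summits.AtomisticToContinuum.BoseEinsteinCondensation.Theorems.BECHardSphereReductionZeroModeGlue
import Summits.AtomisticToContinuum.BoseEinsteinCondensation.Theorems.BECHardSphereReductionHardSphereScaling
import Summits.AtomisticToContinuum.BoseEinsteinCondensation.Theorems.BECHardSphereReductionZeroModeNonVacuity
import Summits.AtomisticToContinuum.BoseEinsteinCondensation.Theorems.BECHardSphereReductionHardSphereBECStubSectorOccupation
import Summits.AtomisticToContinuum.BoseEinsteinCondensation.Theorems.BECHardSphereReductionHardSphereBECStubSmoothSectors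
import Summits.AtomisticToContinuum.BoseEinsteinCondensation.Theorems.BECHardSphereReductionHardSphereBECStubSectorTransferOf
import Summits.AtomisticToContinuum.BoseEinsteinCondensation.Theorems.BECHardSphereReductionHardSphereBECMajorityReduction
import Summits.AtomisticToContinuum.BoseEinsteinCondensation.Theorems.BECHardSphereReductionHardSphereBECMajorityLocal
import Summits.AtomisticToContinuum.BoseEinsteinCondensation.Theorems.BECRieszReverseHolderMajorityPositivityTransfer
import Summits.AtomisticToContinuum.BoseEinsteinCondensation.Theorems.BECHardSphereReductionHardSphereBECPositivityTransferHS
import HarnessLib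

/-!
# Birth skeleton v5.3 — crux `HardSphereBEC` (stmt-AtomisticToContinuum-11885), route `BECHardSphereReduction`

`Lines/birth.lean` of the crux, as RESHAPED by lead c8 (v5, 2026-08-17) and weakened by lead c9 (v5.3: density-dependent
majority constant, 2026-08-17).  The crux, BY NAME:
`Summit.AtomisticToContinuum.BoseEinsteinCondensation.Theses.BECHardSphereReduction.HardSphereBEC`
= `∀ a > 0, ∃ ρ₀ > 0, ∀ ρ ∈ (0, ρ₀), HasGroundStateBEC HS_a ρ`, `HS_a = Set.indicator (Set.Iic a) ⊤`
(dilute hard-sphere BEC in the thermodynamic limit; LSSY's open problem in the model case).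
Units `a = 1`; `L = L_N(η) = (N/η)^{1/3}`; `φ₀ = L^{-3/2}·1_{Λ_L}`; `occ₀(Θ) = ⟨φ₀, γ_Θ φ₀⟩`.

## History of the line
* registrar / leads c1–c3: crux ⟸ sparse zero-mode BEC (11888 weakened) ∧ density monotonicity (⟸ 11886);
* lead c4: the zero-mode stub is an INFRARED statement (ultraviolet half proved, p147997);
* lead c6: monotone input weakened to per-ratio retention (uniformity in the ratio is free; S3–S6' landed);
* lead c7 (v4): the `∀Ψ` infrared stub split into a physics kernel for NONNEGATIVE near-minimisers (window
  bound, `stub_windowBoundNonneg`) and a formal kernel (`stub_positivityTransferHS`: nonneg ⟶ all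
  near-minimisers, ⟸ `GroundStateRigidity` 9072 at HS₁ ⟸ `CubeConnected`), keeping `stub_perRatioRetention`
  (⟸ 11886 | 11884).  v4 thus rested on THREE independent open conjectures.
* lead c8 (this file, v5): **the positivity transfer needs no rigidity above condensate fraction 1/2.**
  PHASE-SECTOR ARGUMENT (new): split a near-minimiser `Ψ` into its four phase sectors
  `P₁ = (Re Ψ)⁺, P₂ = (Re Ψ)⁻, P₃ = (Im Ψ)⁺, P₄ = (Im Ψ)⁻`.  Slice-wise (`u = Ψ(·, Y)`, `A_j = ∫φ₀P_j`),
  `|∫φ₀u|² = (A₁−A₂)² + (A₃−A₄)²` and `(∫φ₀|u|)² ≥ (A₁+A₂)² + (A₃+A₄)²` (the norm of the integral of the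
  vector `(|Re u|, |Im u|)` is at most the integral of its norm), so `|∫φ₀u|² + (∫φ₀|u|)² ≥ 2ΣA_j²`, and
  `(∫φ₀|u|)² ≤ ∫|u|²`; integrating `dY`: `occ₀(Ψ) + N ≥ 2 Σ_j occ₀(P_j)` (`stub_sectorOccupation`).  Each
  sector, smoothed to a `C¹` nonnegative function dominated by it (`stub_smoothSectors`: the four smoothed
  sectors are dominated IN SUM by `Ψ` in kinetic density and in modulus) and normalised, is again a
  near-minimiser, with slack `(E₀(1 − ΣA_i) + δ)/A_j` on the sectors of mass `A_j ≥ τ`; a zero-mode bound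
  `cN` for NONNEGATIVE near-minimisers therefore gives `occ₀(Ψ) ≥ (2c − 1 − o(1))N` for ALL near-minimisers
  (`sectorTransfer`, every `v`, every `(N, L)` with `E₀ < ⊤`; the constant `2c − 1` is sharp: two
  `Y`-overlapping components in antiphase).  Consequently the crux follows from ONE physics kernel,
  `stub_majorityPositiveZeroMode`: nonnegative near-minimisers of the unit-hard-sphere Dirichlet energy at
  `L_N(η)` occupy `φ₀` with a fraction `c > 1/2`, for all `η` below a threshold, eventually in `N`
  (Bogoliubov: `1 − 1.50√η`).  External debt of the crux: v4 `{11888-type kernel, 9072|HS₁, 11884|11886}`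
  ⟶ v5 `{S1⁺}`.  The v4 composition remains available as landed theorems (p157278, p160057, p160296, p161428).
* lead c9 (v5.3): the composition never used the uniformity of the majority constant over the density
  interval (11888 and `HasGroundStateBEC` take a density-dependent constant), so the registered stub is
  WEAKENED to the density-local form S1⁺_loc `∃ η₁ > 0, ∀ η ∈ (0,η₁), ∃ c > 1/2, ∀ᶠ N, …`
  (`stub_localMajorityPositiveZeroMode`; glue `MajorityLocal.hardSphereBEC_of_localMajority`, p172267;
  `localMajority_of_majority`: v5 stub ⟹ v5.3 stub).  S1⁺_loc is VERBATIM the instance `v := HS₁` of the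
  summit-wide majority form of `PositiveZeroMode` (hypothesis of p166887; `localMajority_of_generalMajority`),
  so one filed statement serves the crux, item 11888 and the conjunct.

## Registered stubs (skeleton v5.3; T1–T3 LANDED in c8's wave 1: p164230, p165003, p166374 + p166621)

* `stub_localMajorityPositiveZeroMode` (S1⁺_loc — THE PHYSICS KERNEL, open; lead): `∃ η₁ > 0, ∀ η ∈ (0,η₁),
  ∃ c > 1/2, ∀ᶠ N, ∃ δ > 0`, every NONNEGATIVE `δ`-near-minimiser `Φ` of the HS₁ Dirichlet energy at `L_N(η)`
  has `occ₀(Φ) ≥ cN`.  (= the majority form of `PositiveZeroMode` 12839 at `v := HS₁`, density-dependent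
  constant pinned above `1/2`; weaker than the v5 stub `stub_majorityPositiveZeroMode`, which asked one `c`
  for the whole interval — `MajorityLocal.localMajority_of_majority`.)
* `stub_sectorOccupation` (T1, LANDED p164230, `Theorems/…HardSphereBECStubSectorOccupation.lean`): `2 Σ_{4 sectors} occ₀(P_j) ≤ occ₀(Θ) + N ∫|Θ|²` for
  every continuous `Θ` vanishing off the box.
* `stub_smoothSectors` (T2, LANDED p165003, `Theorems/…HardSphereBECStubSmoothSectors.lean`): for a trial state `Ψ` and `ε > 0`, four `C¹`, Bose-symmetric,
  real nonnegative functions `G_j`, vanishing where `Ψ` does, with `Σ_j |∇G_j|² ≤ |∇Ψ|²`, `Σ_j G_j² ≤ |Ψ|²`,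
  `G_j ≤ P_j ≤ G_j + ε` pointwise (e.g. `G_j = p_ε ∘ (±Re Ψ, ±Im Ψ)`, `p_ε(t) = (t⁺)²/(√(t²+ε²)+ε)`).
* `stub_sectorTransfer_of` (T3, LANDED p166621 with prelims p166374, `Theorems/…HardSphereBECStubSectorTransfer{Prelims,Of}.lean`): T1-statement → T2-statement → at every `(v, N, L)` with
  `L > 0`, `E₀ < ⊤`: `occ₀ ≥ cN` (`c > 1/2`) on the nonnegative `δ₁`-near-minimisers ⟹ `occ₀ ≥ (c − 1/2)N` on
  all `δ₂`-near-minimisers, for some `δ₂ > 0` (the ε/τ bookkeeping; glue `sectorTransfer := T3 T1 T2`).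

Composition (kernel-checked, no sorry outside the stub): `phaseSectorTransfer := T3 T1 T2` (LANDED p166880);
S1⁺_loc ⟹ `HardSphereZeroMode` (11888's signature, `MajorityLocal.hardSphereZeroMode_of_localMajority`, p172267,
with `E₀(HS₁,N,L_N η) < ⊤` eventually for `η < 1/8`) ⟹ the crux BY NAME (`MajorityLocal.hardSphereBEC_of_localMajority`,
p172267, through `hardSphereBEC_of_zeroMode_of_scaling` p97804 + `hardSphereScaling_proof`).  Summit-wide:
majority `PositiveZeroMode` (every admissible `v`) ⟹ `BoseEinsteinCondensation` without 9072 (p166887).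

Closure map: crux ⟸ S1⁺_loc (T1, T2, T3 are tree theorems, imported);  S1⁺_loc ⟸ complete positive-state BEC of
hard spheres (any proof of 12839|HS₁ with constant > 1/2 at each density).  11888 `HardSphereZeroMode` ⟸ S1⁺_loc
(this file).
-/

noncomputable section

namespace Summit.AtomisticToContinuum.BoseEinsteinCondensation.Cruxes.HardSphereBEC.Birth

open MeasureTheory ENNReal Filter Literature.MathematicalPhysics.QuantumManyBody.BoseGas
open Summit.AtomisticToContinuum.BoseEinsteinCondensation.Theses.BECHardSphereReduction
open Summit.AtomisticToContinuum.BoseEinsteinCondensation.Theorems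

/-! ## Registered stubs -/

/-- **S1⁺_loc — MAJORITY ZERO-MODE CONDENSATION OF THE NONNEGATIVE NEAR-MINIMISERS, density by density**
(the physics kernel of the line; v5 by lead c8, weakened to the density-local constant by lead c9; open):
there is a threshold `η₁ > 0` such that for every reduced density `η ∈ (0, η₁)` some fraction `c > 1/2`
works: for all large `N`, some slack `δ > 0` makes every NONNEGATIVE (`Φ = ‖Φ‖` pointwise)
`δ`-near-minimiser `Φ` of the unit-hard-sphere Dirichlet energy in the box `L_N(η) = (N/η)^{1/3}` occupy
the flat mode `φ₀ = L^{-3/2}·1_{Λ_L}` at least `cN` times.  Thermodynamic-limit content of LSSY's open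
problem for positive states (Bogoliubov prediction `1 − 1.50√η`); VERBATIM the instance `v := HS₁` of the
majority form of `PositiveZeroMode` (stmt-12839 with the constant pinned above `1/2`). -/
theorem stub_localMajorityPositiveZeroMode :
    ∃ η₁ : ℝ, 0 < η₁ ∧ ∀ η : ℝ, 0 < η → η < η₁ → ∃ c : ℝ, 1 / 2 < c ∧ ∀ᶠ N : ℕ in Filter.atTop, ∃ δ : ENNReal, 0 < δ ∧ ∀ Φ : Literature.MathematicalPhysics.QuantumManyBody.BoseGas.TrialState N (Literature.MathematicalPhysics.QuantumManyBody.BoseGas.sideLength η N), Literature.MathematicalPhysics.QuantumManyBody.BoseGas.energy (Set.indicator (Set.Iic 1) (fun _ : ℝ => (⊤ : ENNReal))) Φ ≤ Literature.MathematicalPhysics.QuantumManyBody.BoseGas.groundStateEnergy (Set.indicator (Set.Iic 1) (fun _ : ℝ => (⊤ : ENNReal))) N (Literature.MathematicalPhysics.QuantumManyBody.BoseGas.sideLength η N) + δ → (∀ X, Φ.ψ X = (‖Φ.ψ X‖ : ℂ)) → ENNReal.ofReal (c * N) ≤ Literature.MathematicalPhysics.QuantumManyBody.BoseGas.occupation N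 ((Literature.MathematicalPhysics.QuantumManyBody.BoseGas.box (Literature.MathematicalPhysics.QuantumManyBody.BoseGas.sideLength η N)).indicator fun _ => ((Real.sqrt (Literature.MathematicalPhysics.QuantumManyBody.BoseGas.sideLength η N ^ 3))⁻¹ : ℂ)) Φ.ψ := by
  sorry

/-! ## Proved glue (no sorry below this line) -/

/-- **THE SKELETON THEOREM — the crux BY NAME from the registered stub** (the only theorem of this file
whose conclusion is the crux constant; no hypotheses; its only `sorry` is `stub_localMajorityPositiveZeroMode`):
S1⁺_loc ⟹ `HardSphereZeroMode` (phase-sector transfer at each density, LANDED: `phaseSectorTransfer` =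
`stub_sectorTransfer_of stub_sectorOccupation stub_smoothSectors`, p166880 over p164230/p165003/p166621;
density-local glue `MajorityLocal.hardSphereZeroMode_of_localMajority`, p172267) ⟹ the crux with the PROVED
scale covariance (`MajorityLocal.hardSphereBEC_of_localMajority`, p172267, through
`hardSphereBEC_of_zeroMode_of_scaling` p97804 + `hardSphereScaling_proof`). -/
theorem HardSphereBEC_of :
    Summit.AtomisticToContinuum.BoseEinsteinCondensation.Theses.BECHardSphereReduction.HardSphereBEC :=
  MajorityLocal.hardSphereBEC_of_localMajority stub_localMajorityPositiveZeroMode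

/-! ## Closure map of the remaining stub (proved remarks) -/

/-- **What S1⁺_loc buys beyond the crux**: item 11888 `HardSphereZeroMode` (the zero-mode bound for ALL
near-minimisers), by the landed reduction `MajorityLocal.hardSphereZeroMode_of_localMajority` (p172267).
[folklore] -/
theorem hardSphereZeroMode_of_stub : HardSphereZeroMode :=
  MajorityLocal.hardSphereZeroMode_of_localMajority stub_localMajorityPositiveZeroMode

/-- **The summit-wide form of the kernel** (for the planners): the MAJORITY form of `PositiveZeroMode`
(stmt-12839 with `∃ c > 1/2`, every admissible `v`) closes the whole conjunct `BoseEinsteinCondensation`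
WITHOUT `GroundStateRigidity` (stmt-9072) — `boseEinsteinCondensation_of_majorityPositiveZeroMode`
(p166887); the registered stub S1⁺_loc is VERBATIM its instance `v := HS₁`
(`MajorityLocal.localMajority_of_generalMajority`, p172267) — one filed statement serves crux, 11888 and
conjunct. [folklore] -/
theorem boseEinsteinCondensation_of_majority
    (h : ∀ v : ℝ → ENNReal, Literature.MathematicalPhysics.QuantumManyBody.BoseGas.IsRepulsiveFiniteRange v → ∃ ρ₀ : ℝ, 0 < ρ₀ ∧ ∀ ρ : ℝ, 0 < ρ → ρ < ρ₀ → ∃ c : ℝ, 1 / 2 < c ∧ ∀ᶠ N : ℕ in Filter.atTop, ∃ δ : ENNReal, 0 < δ ∧ ∀ Ψ : Literature.MathematicalPhysics.QuantumManyBody.BoseGas.TrialState N (Literature.MathematicalPhysics.QuantumManyBody.BoseGas.sideLength ρ N), Literature.MathematicalPhysics.QuantumManyBody.BoseGas.energy v Ψ ≤ Literature.MathematicalPhysics.QuantumManyBody.BoseGas.groundStateEnergy v N (Literature.MathematicalPhysics.QuantumManyBody.BoseGas.sideLength ρ N) + δ → (∀ X, Ψ.ψ X = (‖Ψ.ψ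 X‖ : ℂ)) → ENNReal.ofReal (c * N) ≤ Literature.MathematicalPhysics.QuantumManyBody.BoseGas.occupation N ((Literature.MathematicalPhysics.QuantumManyBody.BoseGas.box (Literature.MathematicalPhysics.QuantumManyBody.BoseGas.sideLength ρ N)).indicator fun _ => ((Real.sqrt (Literature.MathematicalPhysics.QuantumManyBody.BoseGas.sideLength ρ N ^ 3))⁻¹ : ℂ)) Ψ.ψ) :
    Literature.MathematicalPhysics.QuantumManyBody.BoseGas.BoseEinsteinCondensation :=
  MajorityPositivityTransfer.boseEinsteinCondensation_of_majorityPositiveZeroMode h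

end Summit.AtomisticToContinuum.BoseEinsteinCondensation.Cruxes.HardSphereBEC.Birth

end
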